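import Mathlib.MeasureTheory.Constructions.BorelSpace.Basic
import Mathlib.MeasureTheory.Measure.ProbabilityMeasure
import Mathlib.Topology.MetricSpace.Thickening
import Mathlib.Topology.Sets.VietorisTopology
import HarnessLib

/-!
# The law of a random compact set is determined by its avoidance functional

Topic `Literature/MeasureTheory/RandomSets`. A *random compact set* in a space `α` is a random
element of the hyperspace `NonemptyCompacts α` of nonempty compact subsets of `α`, carrying the
Vietoris topology (Mathlib's `TopologicalSpace.NonemptyCompacts.topology`; for a metric space `α`
this is the topology of the Hausdorff metric, Mathlib's `NonemptyCompacts.instMetricSpace`, whose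
topology is definitionally the Vietoris one) and its Borel σ-algebra. Its *avoidance functional* is
`U ↦ P[X ∩ U = ∅]` (Molchanov, *Theory of Random Sets* (2005), Chap. 1, §1.6, Def. 1.32; the
complementary *hitting* or *capacity functional* is `T_X = 1 - Q_X`). This file proves the
uniqueness half of the Choquet–Kendall–Matheron theorem in the form used for scaling limits of
planar statistical mechanics (clusters, loops and interfaces as random compact sets):

* `isClosed_setOf_disjoint`, `isOpen_setOf_disjoint_of_isClosed` — the *miss events*
  `{K | K ∩ U = ∅}` are closed for `U` open and open for `U` closed (Molchanov 2005, App. C,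
  Thm. C.5 (i));
* `isPiSystem_setOf_disjoint` — the miss events of open sets form a π-system
  (`{K ∩ U = ∅} ∩ {K ∩ V = ∅} = {K ∩ (U ∪ V) = ∅}`);
* `setOf_subset_eq_iUnion_setOf_disjoint_thickening` — in a pseudo-emetric space,
  `{K | K ⊆ U} = ⋃ₙ {K | K ∩ (Uᶜ)^{1/(n+1)} = ∅}` for `U` open (a compact subset of an open set
  keeps a positive distance from its complement);
* `borel_eq_generateFrom_setOf_disjoint` — for a second-countable pseudo-emetric space the Borel
  σ-algebra of the hyperspace is generated by the miss events of open sets (Molchanov 2005,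
  App. C, Thm. C.5 (iii); Castaing–Valadier, LNM 580, Thm. II-10), and
  `borel_eq_generateFrom_setOf_disjoint_of_isTopologicalBasis` — already by the miss events of
  finite unions of sets from any countable basis of `α`;
* `ext_of_forall_measure_setOf_disjoint_eq`, `ext_of_isTopologicalBasis` and their
  `ProbabilityMeasure` forms — **two finite Borel measures on `NonemptyCompacts α` with the same
  mass and the same avoidance functional on open sets (resp. on finite unions of sets of a countable
  basis) are equal** (Molchanov 2005, Chap. 1, §1.6: "the avoidance functional determines
  uniquely the distribution", the uniqueness part of the Choquet theorem, Thm. 1.13, here for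
  random compact sets in any second-countable pseudo-emetric space — local compactness is only
  needed for the existence half, which is not treated).

Everything is stated for Mathlib's `NonemptyCompacts α` with `[MeasurableSpace] [BorelSpace]`
instances as parameters (the percolation files instantiate them for `α = ℂ` by `borel`); no new
definitions are introduced: the miss event of `U` is written `{K | Disjoint (K : Set α) U}`.

## References

* I. Molchanov, *Theory of Random Sets*, Probability and its Applications, Springer, London
  (2005), Chap. 1, §1.2, Thm. 1.13 (Choquet theorem), §1.6 (Def. 1.32 and the paragraph after
  it, pp. 22–23), App. C, Thm. C.5 [Molchanov2005].
* C. Castaing, M. Valadier, *Convex Analysis and Measurable Multifunctions*, Lecture Notes in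
  Math. 580, Springer (1977), Thms. II-6, II-10 (the source quoted by Molchanov for Thm. C.5; not
  needed here).
* G. Matheron, *Random Sets and Integral Geometry*, Wiley (1975), §2.2 (historical source of the
  uniqueness statement; not needed here).
-/

noncomputable section

open Set Filter TopologicalSpace MeasureTheory
open scoped ENNReal Topology

namespace Literature.MeasureTheory.RandomSets

/-! ### Miss events: topology and the π-system property -/

section Topology

variable {α : Type*} [TopologicalSpace α]

/-- Membership in a miss event, as an intersection: `K ∩ U = ∅`. [folklore] -/
theorem mem_setOf_disjoint_iff {U : Set α} {K : NonemptyCompacts α} :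
    K ∈ {K : NonemptyCompacts α | Disjoint (K : Set α) U} ↔ (K : Set α) ∩ U = ∅ := by
  rw [mem_setOf_eq, disjoint_iff_inter_eq_empty]

/-- The miss event of `U` is the complement of the hit event of `U`. [folklore] -/
theorem setOf_disjoint_eq_compl (U : Set α) :
    {K : NonemptyCompacts α | Disjoint (K : Set α) U} =
      {K : NonemptyCompacts α | ((K : Set α) ∩ U).Nonempty}ᶜ := by
  ext K
  simp only [mem_setOf_eq, mem_compl_iff, not_nonempty_iff_eq_empty, disjoint_iff_inter_eq_empty]

/-- **Miss events of open sets are closed** in the Vietoris (= Hausdorff-metric) topology on the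
nonempty compact sets (Molchanov 2005, App. C, Thm. C.5 (i): the hit event `{K ∩ G ≠ ∅}` of an
open `G` is open). [cite: Molchanov2005, App. C, Thm. C.5 (i)] -/
theorem isClosed_setOf_disjoint {U : Set α} (hU : IsOpen U) :
    IsClosed {K : NonemptyCompacts α | Disjoint (K : Set α) U} := by
  rw [setOf_disjoint_eq_compl]
  exact (NonemptyCompacts.isOpen_inter_nonempty_of_isOpen hU).isClosed_compl

/-- **Miss events of closed sets are open** in the Vietoris topology (the hit event of a closed set
is closed). [cite: Molchanov2005, App. C, Def. C.1 and Thm. C.5] -/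
theorem isOpen_setOf_disjoint_of_isClosed {F : Set α} (hF : IsClosed F) :
    IsOpen {K : NonemptyCompacts α | Disjoint (K : Set α) F} := by
  rw [setOf_disjoint_eq_compl]
  exact (NonemptyCompacts.isClosed_inter_nonempty_of_isClosed hF).isOpen_compl

/-- Miss events are antitone in the set: `U ⊆ V` gives `{K ∩ V = ∅} ⊆ {K ∩ U = ∅}`. [folklore] -/
theorem setOf_disjoint_mono {U V : Set α} (h : U ⊆ V) :
    {K : NonemptyCompacts α | Disjoint (K : Set α) V} ⊆
      {K : NonemptyCompacts α | Disjoint (K : Set α) U} :=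
  fun _ hK => Disjoint.mono_right h hK

/-- The miss event of a union is the intersection of the miss events. [folklore] -/
theorem setOf_disjoint_union (U V : Set α) :
    {K : NonemptyCompacts α | Disjoint (K : Set α) (U ∪ V)} =
      {K : NonemptyCompacts α | Disjoint (K : Set α) U} ∩
        {K : NonemptyCompacts α | Disjoint (K : Set α) V} := by
  ext K
  simp only [mem_setOf_eq, mem_inter_iff, disjoint_union_right]

/-- The miss event of an indexed union over a finset is the intersection of the miss events.
[folklore] -/
theorem setOf_disjoint_biUnion_finset {ι : Type*} (s : Finset ι) (U : ι → Set α) :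
    {K : NonemptyCompacts α | Disjoint (K : Set α) (⋃ i ∈ s, U i)} =
      ⋂ i ∈ s, {K : NonemptyCompacts α | Disjoint (K : Set α) (U i)} := by
  ext K
  simp only [mem_setOf_eq, mem_iInter, disjoint_iUnion_right]

/-- **The miss events of open sets form a π-system**:
`{K ∩ U = ∅} ∩ {K ∩ V = ∅} = {K ∩ (U ∪ V) = ∅}` and `U ∪ V` is open. [folklore] -/
theorem isPiSystem_setOf_disjoint :
    IsPiSystem {S : Set (NonemptyCompacts α) |
      ∃ U : Set α, IsOpen U ∧ S = {K : NonemptyCompacts α | Disjoint (K : Set α) U}} := by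
  rintro _ ⟨U, hU, rfl⟩ _ ⟨V, hV, rfl⟩ _
  exact ⟨U ∪ V, hU.union hV, (setOf_disjoint_union U V).symm⟩

/-- **The miss events of finite unions of sets from a family `b` form a π-system.** [folklore] -/
theorem isPiSystem_setOf_disjoint_finset (b : Set (Set α)) :
    IsPiSystem {S : Set (NonemptyCompacts α) | ∃ F : Finset (Set α), ↑F ⊆ b ∧
      S = {K : NonemptyCompacts α | Disjoint (K : Set α) (⋃ V ∈ F, V)}} := by
  classical
  rintro _ ⟨F, hF, rfl⟩ _ ⟨G, hG, rfl⟩ _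
  refine ⟨F ∪ G, ?_, ?_⟩
  · rw [Finset.coe_union]
    exact union_subset hF hG
  · rw [← setOf_disjoint_union]
    congr 1
    ext K
    simp only [Finset.set_biUnion_union]

end Topology

/-! ### The Borel σ-algebra of the hyperspace is generated by the miss events -/

section Borel

variable {α : Type*} [PseudoEMetricSpace α]

/-- **A compact set inside an open set keeps a positive distance from the complement**:
for `U` open, `{K | K ⊆ U} = ⋃ₙ {K | K ∩ (Uᶜ)_{1/(n+1)} = ∅}`, where `(Uᶜ)_ε` is the open
`ε`-thickening of `Uᶜ` (Molchanov 2005, App. C, proof of Thm. C.5 (iii)).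
[cite: Molchanov2005, App. C, Thm. C.5] -/
theorem setOf_subset_eq_iUnion_setOf_disjoint_thickening {U : Set α} (hU : IsOpen U) :
    {K : NonemptyCompacts α | (K : Set α) ⊆ U} =
      ⋃ n : ℕ, {K : NonemptyCompacts α |
        Disjoint (K : Set α) (Metric.thickening (1 / ((n : ℝ) + 1)) Uᶜ)} := by
  ext K
  simp only [mem_setOf_eq, mem_iUnion]
  constructor
  · intro hKU
    obtain ⟨δ, hδ, hδU⟩ := K.isCompact.exists_thickening_subset_open hU hKU
    obtain ⟨n, hn⟩ := exists_nat_one_div_lt hδ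
    refine ⟨n, disjoint_left.2 fun x hxK hx => ?_⟩
    rw [Metric.mem_thickening_iff_exists_edist_lt] at hx
    obtain ⟨y, hyU, hxy⟩ := hx
    have hy : y ∈ Metric.thickening δ (K : Set α) := by
      rw [Metric.mem_thickening_iff_exists_edist_lt]
      refine ⟨x, hxK, ?_⟩
      rw [edist_comm]
      exact lt_trans hxy (ENNReal.ofReal_lt_ofReal_iff_of_nonneg (by positivity) |>.2 hn)
    exact hyU (hδU hy)
  · rintro ⟨n, hn⟩ x hxK
    by_contra hxU
    have hx : x ∈ Metric.thickening (1 / ((n : ℝ) + 1)) Uᶜ :=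
      Metric.self_subset_thickening (by positivity) _ hxU
    exact disjoint_left.1 hn hxK hx

variable [SecondCountableTopology α]

/-- **The Borel σ-algebra of the space of nonempty compact sets is generated by the miss events of
open sets** (Molchanov 2005, App. C, Thm. C.5 (iii) (2), stated there for the hit events, whose
complements the miss events are; Castaing–Valadier, LNM 580 (1977), Thm. II-10). Here `α` is any
second-countable pseudo-emetric space and `NonemptyCompacts α` carries the Vietoris topology, which
is the topology of the Hausdorff (e)metric. Proof: the hyperspace is second countable, so its Borel
σ-algebra is generated by the Vietoris subbase `{K ⊆ U}`, `{K ∩ V ≠ ∅}` (`U`, `V` open); the latter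
are complements of miss events and the former countable unions of them
(`setOf_subset_eq_iUnion_setOf_disjoint_thickening`).
[cite: Molchanov2005, App. C, Thm. C.5 (iii)] -/
theorem borel_eq_generateFrom_setOf_disjoint :
    borel (NonemptyCompacts α) = MeasurableSpace.generateFrom {S : Set (NonemptyCompacts α) |
      ∃ U : Set α, IsOpen U ∧ S = {K : NonemptyCompacts α | Disjoint (K : Set α) U}} := by
  have ht : (NonemptyCompacts.topology : TopologicalSpace (NonemptyCompacts α)) =
      TopologicalSpace.generateFrom (Set.preimage ((↑) : NonemptyCompacts α → Set α) ''
        (powerset '' {U : Set α | IsOpen U} ∪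
          (fun V : Set α => {s : Set α | (s ∩ V).Nonempty}) '' {V : Set α | IsOpen V})) :=
    induced_generateFrom_eq
  rw [borel_eq_generateFrom_of_subbasis ht]
  refine le_antisymm (MeasurableSpace.generateFrom_le ?_) (MeasurableSpace.generateFrom_le ?_)
  · rintro _ ⟨T, hT, rfl⟩
    rcases hT with ⟨U, hU, rfl⟩ | ⟨V, hV, rfl⟩
    · have hpre : ((↑) : NonemptyCompacts α → Set α) ⁻¹' 𝒫 U =
          {K : NonemptyCompacts α | (K : Set α) ⊆ U} := rfl
      rw [hpre, setOf_subset_eq_iUnion_setOf_disjoint_thickening hU]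
      exact MeasurableSet.iUnion fun n =>
        MeasurableSpace.measurableSet_generateFrom ⟨_, Metric.isOpen_thickening, rfl⟩
    · have hpre : ((↑) : NonemptyCompacts α → Set α) ⁻¹' {s : Set α | (s ∩ V).Nonempty} =
          {K : NonemptyCompacts α | Disjoint (K : Set α) V}ᶜ := by
        rw [setOf_disjoint_eq_compl, compl_compl]
        rfl
      rw [hpre]
      refine MeasurableSet.compl ?_
      exact MeasurableSpace.measurableSet_generateFrom ⟨V, hV, rfl⟩
  · rintro _ ⟨U, hU, rfl⟩
    rw [setOf_disjoint_eq_compl]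
    refine MeasurableSet.compl ?_
    exact MeasurableSpace.measurableSet_generateFrom
      ⟨{s : Set α | (s ∩ U).Nonempty}, Or.inr ⟨U, hU, rfl⟩, rfl⟩

omit [SecondCountableTopology α] in
/-- A compact set misses an open set `U` iff it misses every member of a basis contained in `U`.
[folklore] -/
theorem setOf_disjoint_eq_biInter_of_isTopologicalBasis {b : Set (Set α)}
    (hb : IsTopologicalBasis b) {U : Set α} (hU : IsOpen U) :
    {K : NonemptyCompacts α | Disjoint (K : Set α) U} =
      ⋂ V ∈ {V ∈ b | V ⊆ U}, {K : NonemptyCompacts α | Disjoint (K : Set α) V} := by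
  ext K
  simp only [mem_setOf_eq, mem_iInter, and_imp]
  constructor
  · intro hK V _ hVU
    exact hK.mono_right hVU
  · intro h
    rw [disjoint_left]
    intro x hxK hxU
    obtain ⟨V, hVb, hxV, hVU⟩ := hb.exists_subset_of_mem_open hxU hU
    exact disjoint_left.1 (h V hVb hVU) hxK hxV

omit [SecondCountableTopology α] in
/-- **The Borel σ-algebra of the space of nonempty compact sets is generated by the miss events of
finite unions of basic open sets**, for any countable basis `b` of the second-countable
pseudo-emetric space `α`: every miss event of an open set `U` is the countable intersection of the
miss events of the basic sets inside `U`. [cite: Molchanov2005, App. C, Thm. C.5 (iii)] -/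
theorem borel_eq_generateFrom_setOf_disjoint_of_isTopologicalBasis {b : Set (Set α)}
    (hb : IsTopologicalBasis b) (hbc : b.Countable) :
    borel (NonemptyCompacts α) = MeasurableSpace.generateFrom {S : Set (NonemptyCompacts α) |
      ∃ F : Finset (Set α), ↑F ⊆ b ∧
        S = {K : NonemptyCompacts α | Disjoint (K : Set α) (⋃ V ∈ F, V)}} := by
  haveI : SecondCountableTopology α := hb.secondCountableTopology hbc
  rw [borel_eq_generateFrom_setOf_disjoint]
  refine le_antisymm (MeasurableSpace.generateFrom_le ?_) (MeasurableSpace.generateFrom_le ?_)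
  · rintro _ ⟨U, hU, rfl⟩
    rw [setOf_disjoint_eq_biInter_of_isTopologicalBasis hb hU]
    refine MeasurableSet.biInter (hbc.mono (sep_subset _ _)) fun V hV => ?_
    refine MeasurableSpace.measurableSet_generateFrom ⟨{V}, by simpa using hV.1, ?_⟩
    simp
  · rintro _ ⟨F, hF, rfl⟩
    refine MeasurableSpace.measurableSet_generateFrom ⟨⋃ V ∈ F, V, ?_, rfl⟩
    exact isOpen_biUnion fun V hV => hb.isOpen (hF hV)

end Borel

/-! ### Uniqueness: the avoidance functional determines the law -/

section Measure

variable {α : Type*} [PseudoEMetricSpace α] [SecondCountableTopology α]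
  [MeasurableSpace (NonemptyCompacts α)] [BorelSpace (NonemptyCompacts α)]

omit [SecondCountableTopology α] in
/-- Miss events of open sets are Borel measurable (they are closed). [folklore] -/
theorem measurableSet_setOf_disjoint {U : Set α} (hU : IsOpen U) :
    MeasurableSet {K : NonemptyCompacts α | Disjoint (K : Set α) U} :=
  (isClosed_setOf_disjoint hU).measurableSet

omit [SecondCountableTopology α] in
/-- Miss events of closed sets are Borel measurable (they are open). [folklore] -/
theorem measurableSet_setOf_disjoint_of_isClosed {F : Set α} (hF : IsClosed F) :
    MeasurableSet {K : NonemptyCompacts α | Disjoint (K : Set α) F} :=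
  (isOpen_setOf_disjoint_of_isClosed hF).measurableSet

/-- **The avoidance functional on open sets determines a finite Borel measure on the space of
nonempty compact sets** (uniqueness half of the Choquet–Kendall–Matheron theorem; Molchanov
2005, Chap. 1, §1.6, after Def. 1.32: "the avoidance functional `Q_X(K)` … determines uniquely
the distribution of `X`", and Thm. 1.13; here for random compact sets in a second-countable
pseudo-emetric space): two finite Borel measures with the same total mass that agree on every
miss event `{K | K ∩ U = ∅}`, `U` open, are equal. Proof: π-system uniqueness
(`MeasureTheory.ext_of_generate_finite`) with
`isPiSystem_setOf_disjoint` and `borel_eq_generateFrom_setOf_disjoint`.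
[cite: Molchanov2005, Chap. 1, §1.6 (Def. 1.32) and Thm. 1.13] -/
theorem ext_of_forall_measure_setOf_disjoint_eq (μ ν : Measure (NonemptyCompacts α))
    [IsFiniteMeasure μ] (huniv : μ univ = ν univ)
    (h : ∀ U : Set α, IsOpen U →
      μ {K : NonemptyCompacts α | Disjoint (K : Set α) U} =
        ν {K : NonemptyCompacts α | Disjoint (K : Set α) U}) :
    μ = ν := by
  refine ext_of_generate_finite _ ?_ isPiSystem_setOf_disjoint ?_ huniv
  · rw [← borel_eq_generateFrom_setOf_disjoint]
    exact BorelSpace.measurable_eq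
  · rintro _ ⟨U, hU, rfl⟩
    exact h U hU

omit [SecondCountableTopology α] in
/-- **The avoidance functional on finite unions of basic open sets determines a finite Borel
measure on the space of nonempty compact sets**: for a countable basis `b` of `α`, two finite Borel
measures on `NonemptyCompacts α` with the same total mass agreeing on the miss events
`{K | K ∩ (V₁ ∪ … ∪ Vₙ) = ∅}`, `Vᵢ ∈ b`, are equal.
[cite: Molchanov2005, Chap. 1, §1.6 (Def. 1.32) and Thm. 1.13] -/
theorem ext_of_isTopologicalBasis {b : Set (Set α)} (hb : IsTopologicalBasis b)
    (hbc : b.Countable) (μ ν : Measure (NonemptyCompacts α)) [IsFiniteMeasure μ]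
    (huniv : μ univ = ν univ)
    (h : ∀ F : Finset (Set α), ↑F ⊆ b →
      μ {K : NonemptyCompacts α | Disjoint (K : Set α) (⋃ V ∈ F, V)} =
        ν {K : NonemptyCompacts α | Disjoint (K : Set α) (⋃ V ∈ F, V)}) :
    μ = ν := by
  refine ext_of_generate_finite _ ?_ (isPiSystem_setOf_disjoint_finset b) ?_ huniv
  · rw [← borel_eq_generateFrom_setOf_disjoint_of_isTopologicalBasis hb hbc]
    exact BorelSpace.measurable_eq
  · rintro _ ⟨F, hF, rfl⟩
    exact h F hF

/-- **Laws of random compact sets with the same avoidance functional on open sets coincide**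
(`ProbabilityMeasure` form of `ext_of_forall_measure_setOf_disjoint_eq`).
[cite: Molchanov2005, Chap. 1, §1.6 (Def. 1.32) and Thm. 1.13] -/
theorem probabilityMeasure_eq_of_forall_setOf_disjoint
    {μ ν : ProbabilityMeasure (NonemptyCompacts α)}
    (h : ∀ U : Set α, IsOpen U →
      (μ : Measure (NonemptyCompacts α)) {K | Disjoint (K : Set α) U} =
        (ν : Measure (NonemptyCompacts α)) {K | Disjoint (K : Set α) U}) :
    μ = ν := by
  apply Subtype.ext
  exact ext_of_forall_measure_setOf_disjoint_eq (μ : Measure (NonemptyCompacts α))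
    (ν : Measure (NonemptyCompacts α)) (by simp) h

omit [SecondCountableTopology α] in
/-- **Laws of random compact sets with the same avoidance functional on finite unions of basic
open sets coincide** (`ProbabilityMeasure` form of `ext_of_isTopologicalBasis`).
[cite: Molchanov2005, Chap. 1, §1.6 (Def. 1.32) and Thm. 1.13] -/
theorem probabilityMeasure_eq_of_isTopologicalBasis {b : Set (Set α)}
    (hb : IsTopologicalBasis b) (hbc : b.Countable)
    {μ ν : ProbabilityMeasure (NonemptyCompacts α)}
    (h : ∀ F : Finset (Set α), ↑F ⊆ b →
      (μ : Measure (NonemptyCompacts α)) {K | Disjoint (K : Set α) (⋃ V ∈ F, V)} =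
        (ν : Measure (NonemptyCompacts α)) {K | Disjoint (K : Set α) (⋃ V ∈ F, V)}) :
    μ = ν := by
  apply Subtype.ext
  exact ext_of_isTopologicalBasis hb hbc (μ : Measure (NonemptyCompacts α))
    (ν : Measure (NonemptyCompacts α)) (by simp) h

end Measure

end Literature.MeasureTheory.RandomSets
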